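import Summits.QuantumFields.YangMills.Theorems.BalabanUVNodesN07FaceDatumAverage

/-!
# BalabanUVNodes ∕ N07 ([Balaban1985Variational] Theorem 1 (7)–(8), node00-def-P11's typed readings FILE 8 §7 `VariationalThm1RegSepPrinted`, FILE 9
# `VariationalThm1RegSepPrintedCo`, FILE 10 `VariationalThm1RegSepCo6`) — THE «FREE δ₀» OBSTRUCTION (this seat's LOCATED-M4): the three facts are
# UNINHABITED FOR EVERY `B₃` (`0 < a₀`, `0 < a₁`, `N ≥ 2`), through the ONE-SIDED comparability binder

HEADLINE.  The kernel certificate of LOCATED-M4 (INBOX l.17944, INTENT-C′ l.18065, INTENT-20c; cell `pub-ymgap`, Track A, DAG node **N07** = [15]; seat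
`pub-ymgap-dag-n07-e` generation 8; `--kind proof --supports stmt-QuantumFields-20289 --as helper`, the ROW-P11 negative lane).  THEOREMS ONLY.

THE MECHANISM (shared by the three facts — one binder block): the conclusion at `n = 0` reads `omegaPlaqs s.Ω 0 = univ` at threshold `B₃·δ 0·η₀² = B₃·δ 0`
— EVERY fine plaquette of the minimiser —, while the block bounds `δ 0` only from ABOVE (`0 < δ 0 ≤ a₁`, `B₃δ₀ ≤ ε₀`, `δ 0 ≤ 2·δ 1`) and the data hypothesis
`Sect2.DataSmall7P` reads `δ 0` only on the PINNED level-0 plaquettes (`printedPlaqs … 0 ⊆ plaqNoBondIn`: no side with both ends in `Ω₁`).  THE WITNESS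
(`k = 1`, so `SeqSeparated` is vacuous): torus `F.P 1`; `ν.r = 0`, `M = 2`, flat history, so `Ω₁ = D =` the `𝐃₁`-cube of side `2L` at the origin
(17a `exists_seqOfRecord_one`), containing the blocks `B(0)`, `B(e₀)`, `B(e₁)`; the FACE DATUM `U₁` (all fine bonds from `B(0)` into `B(e₀)` twisted by `h`,
`dist1 h = t∕4`): every twisted bond lies inside `D`, so EVERY printed level-0 plaquette is trivial and the level-0 clause of (7) holds for EVERY `δ₀ > 0`;
`W := avgFamily (avOfRecord F N 1) U₁`, whose level-1 member is `Ū₁ =` ONE twisted coarse bond `⟨0, 0⟩` (part A), so (7) at level 1 holds (`4·(t∕4) < δ₁`);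
`U₁` lies in the open class with `2N·A(U₁) < (ε₀∕(16L³))²`, so an OPEN-class (2.12) minimiser `U₀` EXISTS (19a `exists_isMinimizer_holes_of_smallAction`)
and EVERY minimiser has all fine plaquettes `< ε₀∕(16L³)`, whence the co-divergence member (1.9) at `ε₀` (part A §5) — the `h9` of FILE 9 — HOLDS at it;
the coarse plaquette `P⋆ = ⟨0, 0, 1⟩` has its four bonds in `bondsOf (pts 1 D)`, so it is PINNED: `Ū₀(∂P⋆) = Ū₁(∂P⋆) = h`, `dist1 = t∕4`.  THE CONTRADICTION:
at `δ 0 := min(δ₁, t∕(4·C·max(B₃,1)))` (all clauses of the block met) the fact says every fine plaquette of `U₀` is `< B₃δ₀`; then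
`BlockAveragingPlaquetteBound.dist1_plaqHol_avgFun_lt` gives `|Ū₀(∂P⋆) − 1| < C·B₃δ₀ ≤ t∕4` — but it IS `t∕4` (for `B₃δ₀ ≤ 0` the demand fails at any plaquette).

CLASS: refuted-MISSTATED.  Print has ONE `ε₁` for all scales, so its level-0 demand inside `Ω₁` (`B₃ε₁`) is implied by the level-1 demand (`B₃ε₁L⁻²`);
the per-scale reading keeps that implication exactly under the TWO-SIDED comparability C′ `δ (n+1) ≤ 2·δ n` (this seat's `Prop8RegSepPrinted`, p514709,
carries it), which the witness misses (it needs `δ₀ < (t∕4)∕(C·B₃) ≪ δ₁∕2`).  NOTHING of [15] as printed is refuted or asserted.  Count-neutral; N07 ∕ K0⁗ NOT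
discharged; one finite `𝕋⁴` programme at fixed `ε` — NOT continuum ∕ ℝ⁴ ∕ OS ∕ mass gap ∕ Clay.  No `def`, no `sorry`, no `instance`, 0 kit.
DEPENDENCES (by name): parts A1∕A2 `…N07FaceDatumGeometry`∕`…N07FaceDatumAverage`; 19a `…N07SmallActionBoundaryAvoidance`; 17a `…N07Thm1ScaledInterfaceInstance`;
`K0VariationalThm1DatumCoupling.exists_su_dist1_eq`; `BlockAveragingPlaquetteBound.dist1_plaqHol_avgFun_lt`; `Node00.avOfRecord_avg`; def-P11 FILE 8∕9∕10; r12 `B15DeterminingSets`.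
-/

noncomputable section

namespace Summit.QuantumFields.YangMills.BalabanUVNodes.N07Thm1FreeLevelZeroObstruction

open Set
open Literature.MathematicalPhysics.QuantumFieldTheory.Balaban1983to89
open Literature.MathematicalPhysics.QuantumFieldTheory.Balaban1983to89.T4Continuum (T4Family)
open Literature.MathematicalPhysics.QuantumFieldTheory.Balaban1983to89.Node00
open Literature.MathematicalPhysics.QuantumFieldTheory.Balaban1983to89.B15DeterminingSets
open Summit.QuantumFields.YangMills.BalabanUVNodes.N07Thm1ScaledInterfaceInstance
open Summit.QuantumFields.YangMills.BalabanUVNodes.N07SmallActionBoundaryAvoidance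
open Summit.QuantumFields.YangMills.BalabanUVNodes.N07FaceDatumAverage
open Summit.QuantumFields.YangMills.Theorems (K0VariationalThm1DatumCoupling.exists_su_dist1_eq)
open BlockAveraging (avgFun)
open BlockAveragingPlaquetteBound (dist1_plaqHol_avgFun_lt)
open ExpMeanLog (expMeanLogSU deltaSU deltaSU_pos)
open T3DescentFibreTower (expMeanLogSU_E_one)
open scoped Matrix.Norms.L2Operator

section Refutation

variable (F : T4Family) {N : ℕ} [NeZero N]

/-- ★★ **THE «FREE δ₀» INSTANCE OF RECORD** (torus `F.P 1`, `k = 1`): for every `B₃` and all `a₀, a₁ > 0` — given that `dist1` is onto `[0, 2]` on `SU(N)` —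
a (vacuously) separated one-step index `s` (`Ω₁ =` the `2L`-cube of index `0`), thresholds `δ` meeting EVERY binder of the one-sided block (`0 < δ_n ≤ a₁`,
`B₃δ_n ≤ ε₀ ≤ a₀`, `δ₀ ≤ 2δ₁`), a datum `W` satisfying print's (7) on the concord range `Sect2.DataSmall7P … δ W`, such that a (2.12) minimiser over the open
`ε₀`-class EXISTS, and EVERY such minimiser satisfies the co-divergence member (1.9) at `ε₀` and VIOLATES (R) at scale `0`.
[cite: Balaban1985Variational, Thm 1 (7)–(8) pp.278–279; Balaban1988Convergent, (2.10)–(2.12) p.256; Balaban1985RegularSpaces, (1.7)–(1.9) p.77] -/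
theorem exists_freeLevelZero_instance (hG : ∀ t : ℝ, 0 ≤ t → t ≤ 2 → ∃ g : SU N, dist1 g = t) (B₃ : ℝ) {a₀ a₁ : ℝ}
    (ha₀ : 0 < a₀) (ha₁ : 0 < a₁) :
    ∃ (ν : Stage7Numerics) (M : ℕ) (g : ℕ → ℝ) (s : SeqOfRecord F ν M g 1 1) (ε₀ : ℝ) (δ : ℕ → ℝ) (W : MSField (F.P 1) (SU N)),
      Sect2.SeqSeparated ν.M₁ s ∧ (∀ n, n ≤ 1 → 0 < δ n ∧ δ n ≤ a₁ ∧ B₃ * δ n ≤ ε₀) ∧ (∀ n, n < 1 → δ n ≤ 2 * δ (n + 1)) ∧ ε₀ ≤ a₀ ∧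
      Sect2.DataSmall7P (avOfRecord F N 1) s.Ω 1 δ W ∧
      (∃ U₀, IsMinimizer (avOfRecord F N 1) {U | ∀ n, n ≤ 1 → PlaqSmallOn (omegaPlaqs s.Ω n) (ε₀ * (F.P 1).eta n ^ 2) U} (genSet s.Ω 1) W U₀) ∧
      ∀ U₀, IsMinimizer (avOfRecord F N 1) {U | ∀ n, n ≤ 1 → PlaqSmallOn (omegaPlaqs s.Ω n) (ε₀ * (F.P 1).eta n ^ 2) U} (genSet s.Ω 1) W U₀ →
        Sect2.CoDivClassOn s.Ω 1 ε₀ U₀ ∧ ¬ PlaqSmallOn (omegaPlaqs s.Ω 0) (B₃ * δ 0 * (F.P 1).eta 0 ^ 2) U₀ := by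
  -- the one-step index: `r = 0`, `M = 2`, `g ≡ 1`, cube side `2L`
  let ν : Stage7Numerics := ⟨1, 1, 0, 0, 0, 0, 0, 0⟩
  have hside : dCubeSide (F.P 1).L 2 (RkOfRecord (F.P 1).L ν.r ((fun _ : ℕ => (1 : ℝ)) 1)) 1 = 2 * (F.P 1).L := by
    unfold dCubeSide
    rw [show ν.r = 0 from rfl, RkOfRecord_zero_r]
    ring
  have hL1 : 1 ≤ (F.P 1).L := by rw [T4Family.P_L]; have := F.hL.2; omega
  obtain ⟨s, hsΩ⟩ := exists_seqOfRecord_one F ν 2 (fun _ => (1 : ℝ)) 1 (by rw [hside]; omega)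
  rw [hside] at hsΩ
  -- torus bookkeeping
  have hd : (F.P 1).d = 4 := T4Family.P_d F 1
  have hK : 0 + 1 ≤ (F.P 1).m + (F.P 1).K := by have := F.hm; simp only [T4Family.P_m, T4Family.P_K]; omega
  have hn3 : 3 ≤ (F.P 1).sitesPerDir 1 := by
    have h2 : (F.P 1).sitesPerDir 1 = 2 * F.L ^ F.m := by simp [Params.sitesPerDir]
    have h1 : F.L ≤ F.L ^ F.m := (pow_one _).symm.trans_le (Nat.pow_le_pow_right (by have := F.hL.2; omega) F.hm)
    rw [h2]; have := F.hL.2; omega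
  have hLpos : (0 : ℝ) < (F.P 1).L := by exact_mod_cast (show 0 < (F.P 1).L by omega)
  have hL2pos : (0 : ℝ) < ((F.P 1).L : ℝ) ^ 2 := pow_pos hLpos 2; have hL3pos : (0 : ℝ) < ((F.P 1).L : ℝ) ^ 3 := pow_pos hLpos 3
  have hL1r : (1 : ℝ) ≤ (F.P 1).L := by exact_mod_cast hL1
  -- the two directions of the pinned coarse plaquette `P⋆ = ⟨0, μ₀, ν₁⟩`
  let μ0 : Fin (F.P 1).d := ⟨0, by omega⟩
  let ν1 : Fin (F.P 1).d := ⟨1, by omega⟩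
  have hμν : μ0 < ν1 := Fin.mk_lt_mk.mpr zero_lt_one
  set D : Set (Site (F.P 1) 0) := cubeEnl (F.P 1) (2 * (F.P 1).L) 0 0 with hD
  -- thresholds and radii (as in 19b)
  have hδSU := deltaSU_pos (n := Fin N)
  set α₀ : ℝ := min (1 / 109824) (deltaSU (Fin N) / (64 * ((F.P 1).L : ℝ) ^ 2)) with hα₀
  have hα₀pos : 0 < α₀ := lt_min (by norm_num) (div_pos hδSU (mul_pos (by norm_num) hL2pos))
  have hα₀1 : α₀ ≤ 1 / 109824 := min_le_left _ _
  have hα₀2 : α₀ ≤ deltaSU (Fin N) / (64 * ((F.P 1).L : ℝ) ^ 2) := min_le_right _ _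
  have hα3 : (143 * (((((F.P 1).d + 4 : ℕ) : ℝ)) ^ 2 / 4) ^ 2) * α₀ ≤ 1 / 3 := by
    have : (((((F.P 1).d + 4 : ℕ) : ℝ)) ^ 2 / 4) ^ 2 = 256 := by rw [hd]; norm_num
    rw [this]; linarith
  have hα2 : 2 * α₀ ≤ 2 * deltaSU (Fin N) / ((((F.P 1).d + 4) * (F.P 1).L : ℕ) : ℝ) ^ 2 := by
    have : ((((F.P 1).d + 4) * (F.P 1).L : ℕ) : ℝ) ^ 2 = 64 * ((F.P 1).L : ℝ) ^ 2 := by rw [hd]; push_cast; ring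
    rw [this]
    calc 2 * α₀ ≤ 2 * (deltaSU (Fin N) / (64 * ((F.P 1).L : ℝ) ^ 2)) := by linarith
      _ = 2 * deltaSU (Fin N) / (64 * ((F.P 1).L : ℝ) ^ 2) := by ring
  set ε₀ : ℝ := min a₀ (α₀ / (2 * ((F.P 1).L : ℝ) ^ 2)) with hε₀
  have hε₀pos : 0 < ε₀ := lt_min ha₀ (div_pos hα₀pos (mul_pos two_pos hL2pos))
  have hε₀a₀ : ε₀ ≤ a₀ := min_le_left _ _
  have hη1 : (F.P 1).eta 1 ^ 2 = 1 / ((F.P 1).L : ℝ) ^ 2 := by rw [eta_one_sq, T4Family.P_L]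
  have hη13 : (F.P 1).eta 1 ^ 3 = 1 / ((F.P 1).L : ℝ) ^ 3 := by simp [Params.eta]
  have hη0 : (F.P 1).eta 0 ^ 2 = 1 := by simp [Params.eta]
  have hη03 : (F.P 1).eta 0 ^ 3 = 1 := by simp [Params.eta]
  have hεα : ε₀ < α₀ * (F.P 1).eta 1 ^ 2 := by
    rw [hη1]
    have h1 : ε₀ ≤ α₀ / (2 * ((F.P 1).L : ℝ) ^ 2) := min_le_right _ _
    have h2 : α₀ / (2 * ((F.P 1).L : ℝ) ^ 2) < α₀ * (1 / ((F.P 1).L : ℝ) ^ 2) := by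
      rw [mul_one_div, div_lt_div_iff_of_pos_left hα₀pos (mul_pos two_pos hL2pos) hL2pos]
      linarith
    exact h1.trans_lt h2
  set e₁ : ℝ := ε₀ * (F.P 1).eta 1 ^ 2 with he₁
  have he₁pos : 0 < e₁ := mul_pos hε₀pos (by rw [hη1]; exact div_pos one_pos hL2pos)
  -- the finer radius for the co-divergence member: `e₂ = ε₀/(16L³) ≤ e₁`
  set e₂ : ℝ := ε₀ / (16 * ((F.P 1).L : ℝ) ^ 3) with he₂
  have he₂pos : 0 < e₂ := div_pos hε₀pos (by positivity)
  have he₂e₁ : e₂ ≤ e₁ := by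
    rw [he₁, hη1, he₂, mul_one_div]
    have h23 : ((F.P 1).L : ℝ) ^ 2 ≤ ((F.P 1).L : ℝ) ^ 3 := pow_le_pow_right₀ hL1r (by norm_num)
    exact div_le_div_of_nonneg_left hε₀pos.le hL2pos (by linarith)
  set b : ℝ := max B₃ 1 with hb
  have hb1 : 1 ≤ b := le_max_right _ _
  have hbB : B₃ ≤ b := le_max_left _ _
  have hb0 : 0 < b := by linarith
  set δ₁ : ℝ := min a₁ (ε₀ / b) with hδ₁
  have hδ₁pos : 0 < δ₁ := lt_min ha₁ (div_pos hε₀pos hb0)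
  have hδ₁a : δ₁ ≤ a₁ := min_le_left _ _
  have hBδ₁ : B₃ * δ₁ ≤ ε₀ :=
    calc B₃ * δ₁ ≤ b * δ₁ := mul_le_mul_of_nonneg_right hbB hδ₁pos.le
      _ ≤ b * (ε₀ / b) := mul_le_mul_of_nonneg_left (min_le_right _ _) hb0.le
      _ = ε₀ := by field_simp
  -- the averaging constant, the plaquette count, the size `t` of the datum's plaquettes
  set C : ℝ := ((F.P 1).L : ℝ) ^ 2 + 6 * ((((F.P 1).d + 2) * (F.P 1).L : ℕ) : ℝ) ^ 2 with hC
  have hCL : ((F.P 1).L : ℝ) ^ 2 ≤ C := by rw [hC]; exact le_add_of_nonneg_right (by positivity)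
  have hCpos : 0 < C := hL2pos.trans_le hCL
  set cP : ℝ := (Fintype.card (Plaq (F.P 1) 0) : ℝ) with hcP
  have hcP0 : 0 ≤ cP := Nat.cast_nonneg _
  set Mb : ℝ := 2 * N * cP + 1 with hMb
  have hNcP : (0 : ℝ) ≤ 2 * N * cP := mul_nonneg (mul_nonneg zero_le_two (Nat.cast_nonneg N)) hcP0
  have hMb1 : 1 ≤ Mb := by rw [hMb]; linarith
  have hMbpos : 0 < Mb := by linarith
  set t : ℝ := min 1 (min (δ₁ / (2 * C + 1)) (min (e₂ / (2 * Mb)) (deltaSU (Fin N) / (36 * ((F.P 1).L : ℝ) ^ 2 + 1)))) with ht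
  have ht0 : 0 < t := lt_min one_pos (lt_min (div_pos hδ₁pos (by linarith))
    (lt_min (div_pos he₂pos (by linarith)) (div_pos hδSU (by linarith))))
  have ht1 : t ≤ 1 := min_le_left _ _
  have htδ : t ≤ δ₁ / (2 * C + 1) := (min_le_right _ _).trans (min_le_left _ _)
  have hte : t ≤ e₂ / (2 * Mb) := (min_le_right _ _).trans ((min_le_right _ _).trans (min_le_left _ _))
  have htS : t ≤ deltaSU (Fin N) / (36 * ((F.P 1).L : ℝ) ^ 2 + 1) :=
    (min_le_right _ _).trans ((min_le_right _ _).trans (min_le_right _ _))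
  have htδ₁ : t < δ₁ := by
    have h := (le_div_iff₀ (by linarith : (0 : ℝ) < 2 * C + 1)).mp htδ
    have h' : t * (2 * C + 1) = t + 2 * C * t := by ring
    have hpos : 0 < 2 * C * t := mul_pos (mul_pos two_pos hCpos) ht0
    linarith
  have htMb : t * (2 * Mb) ≤ e₂ := (le_div_iff₀ (by linarith)).mp hte
  have hMbt : Mb * t ≤ e₂ / 2 := by
    have h' : t * (2 * Mb) = 2 * (Mb * t) := by ring
    linarith
  have hte2 : t < e₂ := by
    have h2 : t ≤ Mb * t := le_mul_of_one_le_left ht0.le hMb1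
    linarith
  have hte1 : t < e₁ := hte2.trans_le he₂e₁
  have hL2one : (1 : ℝ) ≤ ((F.P 1).L : ℝ) ^ 2 := one_le_pow₀ hL1r
  have htSU : 9 * t / 4 < deltaSU (Fin N) := by
    have h := (le_div_iff₀ (by linarith : (0 : ℝ) < 36 * ((F.P 1).L : ℝ) ^ 2 + 1)).mp htS
    have h' : t * (36 * ((F.P 1).L : ℝ) ^ 2 + 1) = 9 * t / 4 + t * (36 * ((F.P 1).L : ℝ) ^ 2 - 5 / 4) := by ring
    have hpos : 0 < t * (36 * ((F.P 1).L : ℝ) ^ 2 - 5 / 4) := mul_pos ht0 (by linarith)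
    linarith
  -- the twist `h` with `dist1 h = t/4` and the FACE DATUM
  obtain ⟨h, hh⟩ := hG (t / 4) (by linarith) (by linarith)
  let U₁ : GaugeField (F.P 1) 0 (SU N) := fun bd =>
    if blockOf bd.src = 0 ∧ blockOf bd.tgt = (0 : Site (F.P 1) 1).shift μ0 then h else 1
  have hU : ∀ bd : PBond (F.P 1) 0, U₁ bd = if blockOf bd.src = 0 ∧ blockOf bd.tgt = (0 : Site (F.P 1) 1).shift μ0 then h else 1 :=
    fun _ => rfl
  have hU₁le : ∀ q : Plaq (F.P 1) 0, dist1 (GaugeField.plaqHol U₁ q) ≤ t := fun q => by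
    have := dist1_plaqHol_face_le hU q; rw [hh] at this; linarith
  -- the datum: ALL averages of `U₁`; its level-1 member is the single twisted coarse bond
  let W : MSField (F.P 1) (SU N) := avgFamily (avOfRecord F N 1) U₁
  have hW0 : W 0 = U₁ := rfl
  have hW1 : W 1 = avgFun expMeanLogSU U₁ := by
    show (avOfRecord F N 1 0).avg U₁ = _; rw [avOfRecord_avg]
  have hE := fun n : ℕ => expMeanLogSU_E_one (N := Fin N) n
  have hW1le : ∀ q : Plaq (F.P 1) 1, dist1 (GaugeField.plaqHol (W 1) q) ≤ t := fun q => by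
    rw [hW1]; have := dist1_plaqHol_avgFun_face_le expMeanLogSU hE hK hn3 hU q; rw [hh] at this; linarith
  have hW1star : GaugeField.plaqHol (W 1) ⟨0, μ0, ν1, hμν⟩ = h := by
    rw [hW1]; exact plaqHol_avgFun_face_star expMeanLogSU hE hK hn3 hU hμν
  -- thresholds `δ₀ := min(δ₁, t/(4·C·b))`, `δ₁`
  set δ₀ : ℝ := min δ₁ (t / (4 * C * b)) with hδ₀
  have hδ₀pos : 0 < δ₀ := lt_min hδ₁pos (div_pos ht0 (by positivity))
  have hδ₀δ₁ : δ₀ ≤ δ₁ := min_le_left _ _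
  have hbδ₀ : b * δ₀ ≤ t / (4 * C) :=
    calc b * δ₀ ≤ b * (t / (4 * C * b)) := mul_le_mul_of_nonneg_left (min_le_right _ _) hb0.le
      _ = t / (4 * C) := by field_simp
  have hBδ₀ : B₃ * δ₀ ≤ t / (4 * C) := (mul_le_mul_of_nonneg_right hbB hδ₀pos.le).trans hbδ₀
  have hCBδ₀ : C * (B₃ * δ₀) ≤ t / 4 :=
    calc C * (B₃ * δ₀) ≤ C * (t / (4 * C)) := mul_le_mul_of_nonneg_left hBδ₀ hCpos.le
      _ = t / 4 := by field_simp
  let δ : ℕ → ℝ := fun n => if n = 0 then δ₀ else δ₁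
  have hδ0 : δ 0 = δ₀ := rfl
  have hδ1 : δ 1 = δ₁ := rfl
  -- the class membership of `U₁` and its action (for BOTH radii `e₁` and `e₂`)
  have hU₁class : ∀ n, n ≤ 1 → PlaqSmallOn (omegaPlaqs s.Ω n) (ε₀ * (F.P 1).eta n ^ 2) U₁ := by
    intro n hn q _
    exact (hU₁le q).trans_lt (hte1.trans_le (mul_le_mul_of_nonneg_left (eta_sq_le_eta_sq_of_le hn) hε₀pos.le))
  have hact2 : 2 * N * wilsonAction4 U₁ < e₂ ^ 2 := by
    have hA := wilsonAction4_le_card_mul_sq hU₁le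
    have hN0 : (0 : ℝ) ≤ 2 * N := by positivity
    have h1 : 2 * N * wilsonAction4 U₁ ≤ 2 * N * cP * t ^ 2 :=
      calc 2 * N * wilsonAction4 U₁ = (2 * N) * wilsonAction4 U₁ := by ring
        _ ≤ (2 * N) * (cP * t ^ 2) := mul_le_mul_of_nonneg_left hA hN0
        _ = 2 * N * cP * t ^ 2 := by ring
    have h2 : 2 * N * cP < Mb := by rw [hMb]; linarith
    have h3 : 2 * N * cP * t ^ 2 < Mb * t ^ 2 := mul_lt_mul_of_pos_right h2 (pow_pos ht0 2)
    have h4 : Mb * t ≤ e₂ := by linarith [he₂pos]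
    have h5 : Mb * t ^ 2 ≤ e₂ * t :=
      calc Mb * t ^ 2 = (Mb * t) * t := by ring
        _ ≤ e₂ * t := mul_le_mul_of_nonneg_right h4 ht0.le
    have h6 : e₂ * t ≤ e₂ * e₂ := mul_le_mul_of_nonneg_left hte2.le he₂pos.le
    calc 2 * N * wilsonAction4 U₁ ≤ 2 * N * cP * t ^ 2 := h1
      _ < Mb * t ^ 2 := h3
      _ ≤ e₂ * t := h5
      _ ≤ e₂ * e₂ := h6
      _ = e₂ ^ 2 := by ring
  have hact1 : 2 * N * wilsonAction4 U₁ < e₁ ^ 2 :=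
    hact2.trans_le (pow_le_pow_left₀ he₂pos.le he₂e₁ 2)
  -- EXISTENCE of an open-class minimiser (19a)
  have hex := exists_isMinimizer_holes_of_smallAction F 1 1 s.Ω hα₀pos hα3 hα2 hε₀pos.le hεα (W := W) (U₁ := U₁) hU₁class
    (fun _ _ _ => rfl) hact1
  -- the separated-ness, the numerics
  have hsep : Sect2.SeqSeparated ν.M₁ s := fun n h1 hn => by omega
  have hnum : ∀ n, n ≤ 1 → 0 < δ n ∧ δ n ≤ a₁ ∧ B₃ * δ n ≤ ε₀ := by
    intro n hn
    rcases Nat.le_one_iff_eq_zero_or_eq_one.mp hn with rfl | rfl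
    · refine ⟨hδ₀pos, hδ₀δ₁.trans hδ₁a, ?_⟩
      calc B₃ * δ 0 = B₃ * δ₀ := rfl
        _ ≤ b * δ₀ := mul_le_mul_of_nonneg_right hbB hδ₀pos.le
        _ ≤ b * δ₁ := mul_le_mul_of_nonneg_left hδ₀δ₁ hb0.le
        _ ≤ b * (ε₀ / b) := mul_le_mul_of_nonneg_left (min_le_right _ _) hb0.le
        _ = ε₀ := by field_simp
    · exact ⟨hδ₁pos, hδ₁a, hBδ₁⟩
  have hcomp : ∀ n, n < 1 → δ n ≤ 2 * δ (n + 1) := by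
    intro n hn
    obtain rfl : n = 0 := by omega
    show δ₀ ≤ 2 * δ₁
    linarith only [hδ₀δ₁, hδ₁pos]
  -- blocks `B(0)`, `B(e_{μ₀})` inside `Ω₁ = D`; `0`, `e_{μ₀}`, `e_{ν₁}` in `pts 1 D`
  have hB0 : ∀ x : Site (F.P 1) 0, blockOf x = 0 → x ∈ s.Ω 1 := fun x hx => by
    rw [hsΩ]; exact mem_cubeEnl_of_blockOf_eq_zero hK hx
  have hB1 : ∀ x : Site (F.P 1) 0, blockOf x = (0 : Site (F.P 1) 1).shift μ0 → x ∈ s.Ω 1 := fun x hx => by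
    rw [hsΩ]; exact mem_cubeEnl_of_blockOf_eq_shift hK hn3 hx
  have hΓ1 : genSet s.Ω 1 1 = pts 1 (s.Ω 1) := by
    show pts 1 (gammaRegion s.Ω 1 1) = _; rw [gammaRegion_self]
  have hp0 : (0 : Site (F.P 1) 1) ∈ genSet s.Ω 1 1 := by
    rw [hΓ1, hsΩ]; exact emb_zero_mem_cubeEnl_two_mul hK
  have hpμ : (0 : Site (F.P 1) 1).shift μ0 ∈ genSet s.Ω 1 1 := by
    rw [hΓ1, hsΩ]; exact emb_shift_zero_mem_cubeEnl_two_mul hK hn3 μ0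
  have hpν : (0 : Site (F.P 1) 1).shift ν1 ∈ genSet s.Ω 1 1 := by
    rw [hΓ1, hsΩ]; exact emb_shift_zero_mem_cubeEnl_two_mul hK hn3 ν1
  -- print's (7) on the CONCORD range: level 0 is BLIND to the face (no side of a printed plaquette lies inside `Ω₁`), level 1 reads `Ū₁`'s plaquettes
  have h7 : Sect2.DataSmall7P (avOfRecord F N 1) s.Ω 1 δ W := by
    refine ⟨fun q hq => ?_, fun m hm q _ => ?_⟩
    · rw [hW0, plaqHol_face_eq_one_of_plaqNoBondIn hU hB0 hB1 hq.2, GaugeGroup.dist1_one]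
      exact hδ₀pos
    · obtain rfl : m = 0 := by omega
      have hmix : Sect2.mixedField (avOfRecord F N 1) (genSet s.Ω 1 (0 + 1)) (W (0 + 1)) (W 0) = W 1 := by
        rw [hW0, show W (0 + 1) = (avOfRecord F N 1 0).avg U₁ from rfl, mixedField_avg_self]
      rw [hmix]
      exact (hW1le q).trans_lt (htδ₁.trans_le (le_of_eq hδ1.symm))
  -- for EVERY minimiser: (1.9) at `ε₀` holds (small action), and (R) at scale 0 FAILS at `δ₀` (the pinned coarse plaquette)
  have hall : ∀ U₀, IsMinimizer (avOfRecord F N 1)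
      {U | ∀ n, n ≤ 1 → PlaqSmallOn (omegaPlaqs s.Ω n) (ε₀ * (F.P 1).eta n ^ 2) U} (genSet s.Ω 1) W U₀ →
      Sect2.CoDivClassOn s.Ω 1 ε₀ U₀ ∧ ¬ PlaqSmallOn (omegaPlaqs s.Ω 0) (B₃ * δ 0 * (F.P 1).eta 0 ^ 2) U₀ := by
    intro U₀ hU₀
    -- small action ⇒ every plaquette of `U₀` is `< e₂`
    have hAct : wilsonAction4 U₀ ≤ wilsonAction4 U₁ := hU₀.2.2 U₁ hU₁class (fun _ _ _ => rfl)
    have hN0 : (0 : ℝ) ≤ 2 * N := by positivity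
    have hlt2 : 2 * N * wilsonAction4 U₀ < e₂ ^ 2 := (mul_le_mul_of_nonneg_left hAct hN0).trans_lt hact2
    have hq2 : ∀ q : Plaq (F.P 1) 0, dist1 (GaugeField.plaqHol U₀ q) ≤ e₂ := fun q =>
      (dist1_plaqHol_lt_of_wilsonAction4_lt he₂pos.le hlt2 q).le
    refine ⟨?_, ?_⟩
    · -- (1.9): `‖coDivSum‖ ≤ d·2e₂ = ε₀/(2L³) < ε₀η_j³` for `j ≤ 1`
      intro j hj bd _
      have hcd := norm_coDivSum_le U₀ he₂pos.le hq2 bd.src bd.dir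
      have hval : ((F.P 1).d : ℝ) * (2 * e₂) = ε₀ / (2 * ((F.P 1).L : ℝ) ^ 3) := by
        rw [hd, he₂]; push_cast; field_simp; ring
      rw [hval] at hcd
      refine hcd.trans_lt ?_
      have hL3one : (1 : ℝ) ≤ ((F.P 1).L : ℝ) ^ 3 := one_le_pow₀ hL1r
      rcases Nat.le_one_iff_eq_zero_or_eq_one.mp hj with rfl | rfl
      · rw [hη03, mul_one]
        have : ε₀ / (2 * ((F.P 1).L : ℝ) ^ 3) < ε₀ / 1 :=
          div_lt_div_of_pos_left hε₀pos one_pos (by linarith only [hL3one])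
        simpa using this
      · rw [hη13, mul_one_div]
        exact div_lt_div_of_pos_left hε₀pos hL3pos (by linarith only [hL3pos])
    · -- (R) at scale 0 fails at the pinned coarse plaquette
      intro hsm
      have hsm' : ∀ q : Plaq (F.P 1) 0, dist1 (GaugeField.plaqHol U₀ q) < B₃ * δ₀ := fun q => by
        have := hsm q (by rw [omegaPlaqs_zero]; exact Set.mem_univ q)
        rwa [hη0, mul_one, hδ0] at this
      -- the pinned coarse plaquette `P⋆` of `Ū₀` equals that of `Ū₁`, i.e. `h`
      have hpin : GaugeField.plaqHol (avgFun expMeanLogSU U₀) ⟨0, μ0, ν1, hμν⟩ = h := by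
        have hav : (avgFamily (avOfRecord F N 1) U₀) 1 = avgFun expMeanLogSU U₀ := by
          show (avOfRecord F N 1 0).avg U₀ = _; rw [avOfRecord_avg]
        rw [← hW1star, ← hav]
        exact plaqHol_top_eq_of_agreeOn hU₀.2.1 ⟨0, μ0, ν1, hμν⟩ hp0 hpμ hpν
      by_cases hBpos : 0 < B₃ * δ₀
      · have hsmall : PlaqSmall (B₃ * δ₀) U₀ := fun q => hsm' q
        have hguard : ((((F.P 1).d + 2) * (F.P 1).L : ℕ) : ℝ) ^ 2 / 4 * (B₃ * δ₀) < deltaSU (Fin N) := by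
          have h36 : ((((F.P 1).d + 2) * (F.P 1).L : ℕ) : ℝ) ^ 2 / 4 = 9 * ((F.P 1).L : ℝ) ^ 2 := by
            rw [hd]; push_cast; ring
          rw [h36]
          have h1 : 9 * ((F.P 1).L : ℝ) ^ 2 * (B₃ * δ₀) ≤ 9 * ((F.P 1).L : ℝ) ^ 2 * (t / (4 * C)) :=
            mul_le_mul_of_nonneg_left hBδ₀ (by positivity)
          have h2 : 9 * ((F.P 1).L : ℝ) ^ 2 * (t / (4 * C)) ≤ 9 * t / 4 := by
            have htC : 0 ≤ t / (4 * C) := div_nonneg ht0.le (by linarith)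
            have hLC : ((F.P 1).L : ℝ) ^ 2 * (t / (4 * C)) ≤ C * (t / (4 * C)) := mul_le_mul_of_nonneg_right hCL htC
            have hCt : C * (t / (4 * C)) = t / 4 := by field_simp
            have h9 : 9 * ((F.P 1).L : ℝ) ^ 2 * (t / (4 * C)) = 9 * (((F.P 1).L : ℝ) ^ 2 * (t / (4 * C))) := by ring
            rw [h9]
            have h' : ((F.P 1).L : ℝ) ^ 2 * (t / (4 * C)) ≤ t / 4 := hLC.trans_eq hCt
            linarith only [h']
          exact (h1.trans h2).trans_lt htSU
        have hlt := dist1_plaqHol_avgFun_lt (n := Fin N) hK hBpos.le hsmall hguard ⟨0, μ0, ν1, hμν⟩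
        rw [hpin, hh] at hlt
        -- `t/4 < C·B₃δ₀ ≤ t/4`
        exact lt_irrefl _ (hlt.trans_le hCBδ₀)
      · -- `B₃δ₀ ≤ 0`: the scale-0 demand is false at every plaquette
        have h0 := hsm' ⟨emb (0 : Site (F.P 1) 1), μ0, ν1, hμν⟩
        exact hBpos ((GaugeGroup.dist1_nonneg _).trans_lt h0)
  exact ⟨ν, 2, fun _ => 1, s, ε₀, δ, W, hsep, hnum, hcomp, hε₀a₀, h7, hex, hall⟩

/-- ★★★ **FILE 8 §7's FACT IS UNINHABITED AT EVERY `B₃`**: `¬ VariationalThm1RegSepPrinted F N B₃ a₀ a₁` for all `a₀, a₁ > 0`, on any `SU(N)` on which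
`dist1` is onto `[0, 2]` — the (R) sentence at scale `0` fails for a minimiser that EXISTS, at a `δ₀` the one-sided block admits (M4).
[cite: Balaban1985Variational, Thm 1 (7)–(8) pp.278–279; Balaban1988Convergent, (2.10)–(2.12) p.256] -/
theorem not_variationalThm1RegSepPrinted_of_dist1Surj (hG : ∀ t : ℝ, 0 ≤ t → t ≤ 2 → ∃ g : SU N, dist1 g = t) {B₃ a₀ a₁ : ℝ}
    (ha₀ : 0 < a₀) (ha₁ : 0 < a₁) : ¬ VariationalThm1RegSepPrinted F N B₃ a₀ a₁ := by
  intro h15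
  obtain ⟨ν, M, g, s, ε₀, δ, W, hsep, hnum, hcomp, hε₀, h7, ⟨U₀, hU₀⟩, hall⟩ :=
    exists_freeLevelZero_instance F hG B₃ ha₀ ha₁
  exact (hall U₀ hU₀).2 (h15 ν M g 1 1 s hsep ε₀ δ hnum hcomp hε₀ W h7 U₀ hU₀ 0 (Nat.zero_le _))

/-- ★★★ **FILE 9's FACT IS UNINHABITED AT EVERY `B₃`**: `¬ VariationalThm1RegSepPrintedCo F N B₃ a₀ a₁` (`0 < a₀`, `0 < a₁`, `dist1` onto `[0, 2]`) — the
co-divergence hypothesis `h9` HOLDS at the witness's minimiser (small action), so the extra binder does not save the one-sided block (M4).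
[cite: Balaban1985Variational, Thm 1 (2),(7)–(8) pp.278–279; Balaban1985RegularSpaces, (1.7)–(1.9) p.77] -/
theorem not_variationalThm1RegSepPrintedCo_of_dist1Surj (hG : ∀ t : ℝ, 0 ≤ t → t ≤ 2 → ∃ g : SU N, dist1 g = t) {B₃ a₀ a₁ : ℝ}
    (ha₀ : 0 < a₀) (ha₁ : 0 < a₁) : ¬ VariationalThm1RegSepPrintedCo F N B₃ a₀ a₁ := by
  intro h15
  obtain ⟨ν, M, g, s, ε₀, δ, W, hsep, hnum, hcomp, hε₀, h7, ⟨U₀, hU₀⟩, hall⟩ :=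
    exists_freeLevelZero_instance F hG B₃ ha₀ ha₁
  exact (hall U₀ hU₀).2 ((h15 ν M g 1 1 s hsep ε₀ δ hnum hcomp hε₀ W h7 U₀ hU₀ (hall U₀ hU₀).1).1 0 (Nat.zero_le _))

/-- ★★★ **FILE 10's FACT (THE CLASS-(6) RE-KEY OF DIRECTOR-YM №149∕№150) IS UNINHABITED AT EVERY `B₃`**: `¬ VariationalThm1RegSepCo6 F N B₃ a₀ a₁`
(`0 < a₀`, `0 < a₁`, `dist1` onto `[0, 2]`) — through def-P11's own bridge `VariationalThm1RegSepCo6.toPrintedCo` (M4).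
[cite: Balaban1985Variational, Thm 1 (6)–(8) pp.278–279; Balaban1985RegularSpaces, (1.7)–(1.9) p.77] -/
theorem not_variationalThm1RegSepCo6_of_dist1Surj (hG : ∀ t : ℝ, 0 ≤ t → t ≤ 2 → ∃ g : SU N, dist1 g = t) {B₃ a₀ a₁ : ℝ}
    (ha₀ : 0 < a₀) (ha₁ : 0 < a₁) : ¬ VariationalThm1RegSepCo6 F N B₃ a₀ a₁ :=
  fun h => not_variationalThm1RegSepPrintedCo_of_dist1Surj F hG ha₀ ha₁ h.toPrintedCo

/-- ★★★ **`¬ VariationalThm1RegSepPrinted F N B₃ a₀ a₁` FOR EVERY `B₃`, EVERY `N ≥ 2`** (`0 < a₀`, `0 < a₁`; `dist1` is onto `[0, 2]` on `SU(N)`, `N ≥ 2`: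
`K0VariationalThm1DatumCoupling.exists_su_dist1_eq`). [cite: Balaban1985Variational, Thm 1 (7)–(8) pp.278–279] -/
theorem not_variationalThm1RegSepPrinted (hN : 2 ≤ N) {B₃ a₀ a₁ : ℝ} (ha₀ : 0 < a₀) (ha₁ : 0 < a₁) :
    ¬ VariationalThm1RegSepPrinted F N B₃ a₀ a₁ :=
  not_variationalThm1RegSepPrinted_of_dist1Surj F (fun _ h0 h2 => K0VariationalThm1DatumCoupling.exists_su_dist1_eq hN h0 h2) ha₀ ha₁

/-- ★★★ **`¬ VariationalThm1RegSepPrintedCo F N B₃ a₀ a₁` FOR EVERY `B₃`, EVERY `N ≥ 2`** (`0 < a₀`, `0 < a₁`).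
[cite: Balaban1985Variational, Thm 1 (2),(7)–(8) pp.278–279; Balaban1985RegularSpaces, (1.7)–(1.9) p.77] -/
theorem not_variationalThm1RegSepPrintedCo (hN : 2 ≤ N) {B₃ a₀ a₁ : ℝ} (ha₀ : 0 < a₀) (ha₁ : 0 < a₁) :
    ¬ VariationalThm1RegSepPrintedCo F N B₃ a₀ a₁ :=
  not_variationalThm1RegSepPrintedCo_of_dist1Surj F (fun _ h0 h2 => K0VariationalThm1DatumCoupling.exists_su_dist1_eq hN h0 h2) ha₀ ha₁

/-- ★★★ **`¬ VariationalThm1RegSepCo6 F N B₃ a₀ a₁` FOR EVERY `B₃`, EVERY `N ≥ 2`** (`0 < a₀`, `0 < a₁`) — the fact rev 20's V9 stub 1 and the suppliers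
10b∕14c were keyed on; its C′ re-type (two-sided comparability) is the repair. [cite: Balaban1985Variational, Thm 1 (6)–(8) pp.278–279; Balaban1985RegularSpaces, (1.7)–(1.9) p.77] -/
theorem not_variationalThm1RegSepCo6 (hN : 2 ≤ N) {B₃ a₀ a₁ : ℝ} (ha₀ : 0 < a₀) (ha₁ : 0 < a₁) :
    ¬ VariationalThm1RegSepCo6 F N B₃ a₀ a₁ :=
  not_variationalThm1RegSepCo6_of_dist1Surj F (fun _ h0 h2 => K0VariationalThm1DatumCoupling.exists_su_dist1_eq hN h0 h2) ha₀ ha₁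

/-- **THE ONLY INHABITED INSTANCES ARE DEGENERATE**: `VariationalThm1RegSepCo6 F N B₃ a₀ a₁` (`N ≥ 2`) forces `a₀ ≤ 0 ∨ a₁ ≤ 0` — no positive
threshold at all, for any `B₃`. [cite: Balaban1985Variational, Thm 1 (6)–(8) pp.278–279] -/
theorem variationalThm1RegSepCo6_only_degenerate (hN : 2 ≤ N) {B₃ a₀ a₁ : ℝ} (h : VariationalThm1RegSepCo6 F N B₃ a₀ a₁) :
    a₀ ≤ 0 ∨ a₁ ≤ 0 := by
  by_contra hc
  rw [not_or, not_le, not_le] at hc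
  exact not_variationalThm1RegSepCo6 F hN hc.1 hc.2 h

end Refutation

end Summit.QuantumFields.YangMills.BalabanUVNodes.N07Thm1FreeLevelZeroObstruction
end
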